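import Summits.BirchSwinnertonDyer.BirchSwinnertonDyer.Theorems.KatoDescentTamePotSupersingularCartanMuRoadDoorsTprimeFive
import Literature.NumberTheory.EllipticCurves.FineSelmerRankEqualityZywinaG9Five
import HarnessLib

/-!
# Route `KatoDescentTamePotSupersingular` (rung K8, sub-rung B4 (t′), cell `bsd-potss`): U₀ DOOR at the `5S4` rows (Zywina's `G₉`) FROM THE LAYER-0 RANK
# EQUALITY `rank_5 Cl(ℚ(P)) = rank_5 Cl(ℚ(x(P)))` (degrees `24` and `12`) + a displayed inertia input

Seat `bsd-potss-k8t-c4` g26; `--supports stmt-BirchSwinnertonDyer-19982 --as helper`. THEOREMS ONLY (no definition, no named fact, no `sorry`);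
nothing booked; (A), Conjecture A and BSD are proved for NO curve here; items 19202 / 19982 stay OPEN at class level (open inputs class-wide: zeta
crux 24439, lower half of 19984).

`missingUpperBoundAt_five_tame_of_zywinaG9Basis_of_rankEq` — U₀ `MissingUpperBoundAt E 5` at a rank-`0` (t′) row with mod-`5` image `G₉` (`5S4`, the tree's basis data
`σ_u ↦ diag(1,2)`, `σ_w ↦ (0 4; 1 0)`), modulo `hKatoA hGZK hmod`, from the ONE class-group datum `hrank : #Cl(ℚ(E[5])^⟨σ̄_u⟩)[5] = #Cl(ℚ(E[5])^⟨σ̄_w², σ̄_u⟩)[5]`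
(`ℚ(P)`, degree 24, vs `ℚ(x(P))`, degree 12: `G₉` acts transitively on `E[5] ∖ 0` with `Stab(P) = ⟨diag(1,2)⟩`) and the DISPLAYED inertia input
`hcI : σ̄_w² (= −1) ∈ I(𝔮|5)` (the finite criterion of `FineSelmerRankEqualityRoadInertia` fails for `G₉`; per row a ramification datum).  NO classical-`μ`
hypothesis (the `μ`-road records `TameConjAFiveRecords.…` of the `5S4` rows display six).  Literature road: `CoatesSujatha2005.RankEqualityRoad.conjA_five_of_zywinaG9Basis_of_rankEq`
(k8t-c4 g26) ∘ `CartanMuRoadDoorsTprimeFive.missingUpperBoundAt_tame_of_conjA`.  CONDITIONAL; per row; nothing booked; BSD for no curve.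

References: [Kato2004Asterisque] Thm. 14.5 (3); [CoatesSujatha2005] Thm. 3.4; [Iwasawa1956]; [Zywina2015] §1.3; [Cremona2006] Table 1.
-/

set_option autoImplicit false
-- the Theorems directory repeats the summit name (`Summits/BirchSwinnertonDyer/BirchSwinnertonDyer/…`): house rule of the cell
set_option linter.dupNamespace false

noncomputable section

open scoped Classical NumberField Matrix
open WeierstrassCurve Field IntermediateField
  Literature.NumberTheory.EllipticCurves Literature.NumberTheory.EllipticCurves.Rank1Residual
  Literature.NumberTheory.EllipticCurves.Rank1Residual.Typed
  Literature.NumberTheory.GaloisRepresentations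
  Literature.NumberTheory.IwasawaTheory Literature.NumberTheory.EllipticCurves.Zywina2015G9
  Literature.NumberTheory.EllipticCurves.CoatesSujatha2005.RankEqualityRoad
  Summit.BirchSwinnertonDyer.Rank1Residual Summit.BirchSwinnertonDyer.Rank1Residual.Additive
  Summit.BirchSwinnertonDyer.BirchSwinnertonDyer.Theorems

namespace Summit.BirchSwinnertonDyer.BirchSwinnertonDyer.Theorems.TameRankEqRecords

/-- **U₀ `MissingUpperBoundAt E 5` at a rank-`0` (t′) row with image `G₉` (`5S4`) FROM THE RANK EQUALITY** — the named facts `hKatoA hGZK hmod`,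
Cremona's `r_an = 0`, `Addv E 5`, `SubTprime E 5`, `E[5]` irreducible, the `G₉` basis data (`e he σu σw hσu hσw`, displayed), the class-group datum
`hrank : #Cl(ℚ(E[5])^⟨σ̄_u⟩)[5] = #Cl(ℚ(E[5])^⟨σ̄_w², σ̄_u⟩)[5]` and the inertia input `hcI : σ̄_w² ∈ I(𝔮)` for every prime `𝔮 ∋ 5` of `ℚ(E[5])` (displayed).
NO `μ`-hypothesis.  `conjA_five_of_zywinaG9Basis_of_rankEq` ∘ `CartanMuRoadDoorsTprimeFive.missingUpperBoundAt_tame_of_conjA`.  CONDITIONAL; nothing booked;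
BSD for no curve. [cite: Kato2004Asterisque, Thm. 14.5 (3) (p. 236)] [cite: CoatesSujatha2005, §3 Thm. 3.4] [cite: Iwasawa1956, §§3–5]
[cite: Zywina2015, §1.3] -/
theorem missingUpperBoundAt_five_tame_of_zywinaG9Basis_of_rankEq (W : WeierstrassCurve ℚ) [W.IsElliptic] [W.IsGloballyMinimal]
    (hKatoA : Kato2004.rankZero_padicValNat_sha_add_padicValNat_tamagawa_le_of_additive_potGood_of_irreducible_of_fineSelmerDual_fg)
    (hGZK : rank_eq_analyticRank_of_analyticRank_le_one) (hmod : hasEntireLFunction_rat)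
    (hr : W.analyticRank = 0) (hadd : haveI : Fact (Nat.Prime 5) := ⟨by norm_num⟩; Addv W 5)
    (hT : haveI : Fact (Nat.Prime 5) := ⟨by norm_num⟩; SubTprime W 5)
    (hirr : haveI : Fact (Nat.Prime 5) := ⟨by norm_num⟩; W.HasIrreducibleModPGaloisRep 5)
    (e : W.geomTorsion (5 : ℕ) ≃+ (Fin 2 → ZMod 5))
    (he : ∀ σ : absoluteGaloisGroup ℚ, ∃ M ∈ G9, ∀ P : W.geomTorsion (5 : ℕ),
      e (σ • P) = ((M : GL (Fin 2) (ZMod 5)) : Matrix (Fin 2) (Fin 2) (ZMod 5)) *ᵥ e P)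
    (σu σw : absoluteGaloisGroup ℚ) (hσu : ∀ P : W.geomTorsion (5 : ℕ), e (σu • P) = !![1, 0; 0, 2] *ᵥ e P)
    (hσw : ∀ P : W.geomTorsion (5 : ℕ), e (σw • P) = !![0, 4; 1, 0] *ᵥ e P)
    (hrank : Nat.card {d : ClassGroup (𝓞 ↥(fixedField (Subgroup.zpowers (absRestrictNormalHom (W.divisionField 5) σu)))) // d ^ 5 = 1} =
      Nat.card {d : ClassGroup (𝓞 ↥(fixedField (Subgroup.zpowers (absRestrictNormalHom (W.divisionField 5) (σw ^ 2)) ⊔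
        Subgroup.zpowers (absRestrictNormalHom (W.divisionField 5) σu)))) // d ^ 5 = 1})
    (hcI : ∀ (𝔮 : Ideal (𝓞 ↥(W.divisionField 5))) [𝔮.IsMaximal], ((5 : ℕ) : 𝓞 ↥(W.divisionField 5)) ∈ 𝔮 →
      absRestrictNormalHom (W.divisionField 5) (σw ^ 2) ∈ 𝔮.inertia _) :
    haveI : Fact (Nat.Prime 5) := ⟨by norm_num⟩
    MissingUpperBoundAt W 5 := by
  haveI : Fact (Nat.Prime 5) := ⟨by norm_num⟩
  exact CartanMuRoadDoorsTprimeFive.missingUpperBoundAt_tame_of_conjA W hKatoA hGZK hmod 5 hr (by decide) hadd hT hirr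
    (conjA_five_of_zywinaG9Basis_of_rankEq W e he σu σw hσu hσw hrank hcI)

end Summit.BirchSwinnertonDyer.BirchSwinnertonDyer.Theorems.TameRankEqRecords

end
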